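import Mathlib
import Summits.NavierStokesRegularity.NavierStokesRegularity.Theorems.LerayQuarterDissipationFiniteDissipationLiouvilleAveraged
import Summits.NavierStokesRegularity.NavierStokesRegularity.Theorems.LerayQuarterDissipationFiniteDissipationLiouvilleVelocityLSixStretching
import HarnessLib

/-!
# Crux `FiniteDissipationLiouville` (stmt-NavierStokesRegularity-22144): the AVERAGED `L³`-vorticity,
# vorticity-amplitude and `L⁶`-velocity rungs — the thresholds `KS²V₃² < 3`, `C_ω < √3/4`,
# `KS²V₆⁴ < 64/27` with the supremum over time replaced by the parabolic backward average (file 2/2)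

Theorems file of route `LerayQuarterDissipation` (lead prover g16; `--supports` the crux; sequel of
`…Averaged`). Navier–Stokes regularity is NOT proved by anything here; no summit is.

`𝒟_{C,K}`, `Ω = lerayVorticity V` (`Ω(s,y) = (−t)ω(t,√(−t)y)`, `s = −log(−t)`), `KS` = Mathlib's
Gagliardo–Nirenberg–Sobolev constant. The weight `e^{−(s−σ)/2}dσ` on `(−∞, s]` has mass `2`; in
physical time it is `√(−t)/(−τ)^{3/2} dτ` on `(−∞, t)`.

* **`lerayVorticity_eq_zero_of_cube_le_fun`, `eq_zero_of_vorticityLThree_avg_lt`** — if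
  `∫‖Ω(σ)‖³ ≤ β(σ)³` for all `σ`, `β ≥ 0` continuous, and the backward averages obey
  `∫_a^s e^{−(s−σ)/2} β(σ)² dσ ≤ A` (`a ≤ s`) with `KS²A < 6`, then `V ≡ 0` on `t < 0`. For `β ≡ v`
  (`A = 2v²`) this is the sup-rung `KS²v² < 3` of `…VorticityLThree`; in general `β` may exceed
  `√3/KS` on a set of times of small weighted measure — INTERMITTENT large `L³`-vorticity does not
  save a profile from triviality.
* **`lerayVorticity_eq_zero_of_vorticity_le_fun`, `eq_zero_of_vorticityAmplitude_avg_lt`** — if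
  `‖Ω(σ,y)‖ ≤ γ(σ)` for all `σ, y`, `γ ≥ 0` continuous, and `∫_a^s e^{−(s−σ)/2} γ(σ) dσ ≤ Γ`
  (`a ≤ s`) with `Γ < √3/2`, then `V ≡ 0` (`γ ≡ C_ω`, `Γ = 2C_ω`: lead g15's `C_ω < √3/4`). In
  physical variables: `∫_{−∞}^t √(−t)(−τ)^{−3/2}·[(−τ)‖ω(τ)‖_∞] dτ < √3/2` for all `t < 0` forces
  triviality — the MEAN scale-invariant vorticity amplitude below `√3/4`.
* **`lerayVorticity_eq_zero_of_pow_six_le_fun`, `eq_zero_of_velocityLSix_avg_lt`** — if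
  `∫‖U(σ)‖⁶ ≤ w(σ)⁶`, `w ≥ 0` continuous, and `∫_a^s e^{−(s−σ)/2} w(σ)⁴ dσ ≤ A` (`a ≤ s`) with
  `27·KS²A < 128`, then `V ≡ 0` (`w ≡ const`, `A = 2w⁴`: the sup-rung `KS²w⁴ < 64/27` of
  `…VelocityLSix`): the scale-invariant `L⁶` norm `(−t)^{1/4}‖u(t)‖₆` may exceed the threshold
  intermittently.
* `not_singular_of_*_avg_lt` — the regularity forms in the quantifier shape of the crux.

HONEST FRAMING. Necessary conditions on the HYPOTHETICAL singular profile, stated with continuous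
majorants in similarity time; the `(1+δ)`-loss of the product rule is absorbed as in the sup-rungs;
nothing is removed from the catalogued DSS wall (`TypeIDSSLiouville`, NECESSARY for the crux);
nothing here bears on Navier–Stokes regularity or blow-up.
References: Koch–Nadirashvili–Seregin–Šverák 2009 §4–§6; folklore energy method.
-/

noncomputable section

set_option linter.dupNamespace false

namespace Summit.NavierStokesRegularity.NavierStokesRegularity.Theorems.FiniteDissipationLiouville.Averaged

open MeasureTheory Set Filter Topology Metric InnerProductSpace Function Real intervalIntegral
open scoped RealInnerProductSpace ContDiff ENNReal Laplacian
open Literature.Analysis Literature.Analysis.FluidPDE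
open Summit.NavierStokesRegularity.NavierStokesRegularity.Theorems
open Summit.NavierStokesRegularity.NavierStokesRegularity.Theorems.GaussianGap
open Summit.NavierStokesRegularity.NavierStokesRegularity.Theorems.SimilarityEnstrophy
open Summit.NavierStokesRegularity.NavierStokesRegularity.Theorems.SmallDissipationGap
open Summit.NavierStokesRegularity.NavierStokesRegularity.Theorems.FiniteDissipationLiouville.VorticityAmplitude
open Summit.NavierStokesRegularity.NavierStokesRegularity.Theorems.FiniteDissipationLiouville.VorticityLThree
open Summit.NavierStokesRegularity.NavierStokesRegularity.Theorems.FiniteDissipationLiouville.VelocityLSix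

variable {C : ℝ} {V : ℝ → (EuclideanSpace ℝ (Fin 3)) → (EuclideanSpace ℝ (Fin 3))}

/-- From the iterated contraction `Z_∞ ≤ rⁿ M` with `0 ≤ r < 1` to `Ω ≡ 0` (the common ending of the
rungs). [folklore] -/
theorem lerayVorticity_eq_zero_of_contraction (hV : IsTypeIAncientMild C V) {K : ℝ}
    (hK : ∀ t : ℝ, t < 0 → ∫⁻ x, ‖fderiv ℝ (V t) x‖ₑ ^ 2 ≤ ENNReal.ofReal (K / Real.sqrt (-t)))
    {r : ℝ} (hr0 : 0 ≤ r) (hr1 : r < 1)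
    (hstep : ∀ m : ℝ, (∀ s, ∫ y, ‖lerayVorticity V s y‖ ^ 2 ≤ m) →
      ∀ s, ∫ y, ‖lerayVorticity V s y‖ ^ 2 ≤ r * m) :
    ∀ s y, lerayVorticity V s y = 0 := by
  have hΩi := fun σ => integrable_sq_norm_lerayVorticity hV hK σ
  set M : ℝ := ‖curlCLM‖ ^ 2 * max K 0 with hMdef
  have hiter : ∀ n : ℕ, ∀ s, ∫ y, ‖lerayVorticity V s y‖ ^ 2 ≤ r ^ n * M := by
    intro n
    induction n with
    | zero => intro s; rw [pow_zero, one_mul]; exact (hΩi s).2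
    | succ n ih =>
        intro s
        calc ∫ y, ‖lerayVorticity V s y‖ ^ 2 ≤ r * (r ^ n * M) := hstep _ ih s
          _ = r ^ (n + 1) * M := by ring
  have hlim : Tendsto (fun n : ℕ => r ^ n * M) atTop (𝓝 (0 * M)) :=
    (tendsto_pow_atTop_nhds_zero_of_lt_one hr0 hr1).mul_const M
  rw [zero_mul] at hlim
  intro s
  have hcΩ : Continuous (lerayVorticity V s) :=
    (signedBudget_contDiff_lerayVorticity_slice hV s (n := 1)).continuous
  have hE0 : ∫ y, ‖lerayVorticity V s y‖ ^ 2 ≤ 0 := ge_of_tendsto' hlim fun n => hiter n s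
  have hE : ∫ y, ‖lerayVorticity V s y‖ ^ 2 = 0 :=
    le_antisymm hE0 (integral_nonneg fun y => sq_nonneg _)
  have hae : (fun y => ‖lerayVorticity V s y‖ ^ 2) =ᵐ[volume] 0 :=
    (integral_eq_zero_iff_of_nonneg (fun y => sq_nonneg _) (hΩi s).1).1 hE
  have hev : (fun y => ‖lerayVorticity V s y‖ ^ 2) = fun _ => (0 : ℝ) :=
    ((hcΩ.norm.pow 2).ae_eq_iff_eq (μ := volume) continuous_const).1 hae
  intro y
  have hy := congrFun hev y
  have : ‖lerayVorticity V s y‖ = 0 := pow_eq_zero_iff (n := 2) (by norm_num) |>.1 hy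
  exact norm_eq_zero.1 this

/-! ### The averaged `L³`-vorticity rung -/

section LThree

/-- **The averaged `L³`-vorticity rung (similarity form).** Let `V ∈ 𝒟_{C,K}` (any `C`, `K`), let
`β : ℝ → ℝ` be continuous and non-negative with `‖Ω(σ)‖³ ∈ L¹`, `∫‖Ω(σ)‖³ ≤ β(σ)³` for all `σ`, and
suppose the backward averages satisfy `∫_a^s e^{−(s−σ)/2} β(σ)² dσ ≤ A` for all `a ≤ s`, with
`KS²A < 6`. Then `Ω ≡ 0`. With `q = KS²A`, `δ = (6 − q)/(6 + q)`: `b(σ) = (1+δ)KS²β(σ)²/6`, its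
weighted integrals are `≤ (1+δ)q/6 = 2q/(6+q) < 1`, and `…_le_of_forall_one_le_fun` iterates.
[folklore energy method; Gagliardo–Nirenberg–Sobolev] -/
theorem lerayVorticity_eq_zero_of_cube_le_fun (hV : IsTypeIAncientMild C V) {K : ℝ}
    (hK : ∀ t : ℝ, t < 0 → ∫⁻ x, ‖fderiv ℝ (V t) x‖ₑ ^ 2 ≤ ENNReal.ofReal (K / Real.sqrt (-t)))
    {β : ℝ → ℝ} (hβc : Continuous β) (hβ0 : ∀ σ, 0 ≤ β σ)
    (hΩ3 : ∀ σ : ℝ, Integrable (fun y => ‖lerayVorticity V σ y‖ ^ 3) ∧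
      ∫ y, ‖lerayVorticity V σ y‖ ^ 3 ≤ β σ ^ 3)
    {A : ℝ} (hA : ∀ a s : ℝ, a ≤ s → ∫ σ in a..s, Real.exp (-((1 / 2) * (s - σ))) * β σ ^ 2 ≤ A)
    (hq : (SNormLESNormFDerivOfEqConst (EuclideanSpace ℝ (Fin 3))
        (volume : Measure (EuclideanSpace ℝ (Fin 3))) 2 : ℝ) ^ 2 * A < 6) :
    ∀ s y, lerayVorticity V s y = 0 := by
  set KS : ℝ := (SNormLESNormFDerivOfEqConst (EuclideanSpace ℝ (Fin 3))
        (volume : Measure (EuclideanSpace ℝ (Fin 3))) 2 : ℝ) with hKSdef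
  have hKS0 : 0 ≤ KS := NNReal.coe_nonneg _
  obtain ⟨c₁, hc₁0, hc₁⟩ :=
    exists_norm_fderiv_smoothTransition_cutoff_le (E := (EuclideanSpace ℝ (Fin 3)))
  have hA0 : 0 ≤ A := by have := hA 0 0 le_rfl; rwa [intervalIntegral.integral_same] at this
  set q : ℝ := KS ^ 2 * A with hqdef
  have hq0 : 0 ≤ q := by positivity
  have hq6 : q < 6 := hq
  set δ : ℝ := (6 - q) / (6 + q) with hδdef
  have hδ : 0 < δ := div_pos (by linarith) (by linarith)
  set b : ℝ → ℝ := fun σ => (1 + δ) * KS ^ 2 * β σ ^ 2 / 6 with hbdef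
  have hb0 : ∀ σ, 0 ≤ b σ := fun σ => by positivity
  have hbc : Continuous b := ((continuous_const.mul (hβc.pow 2)).div_const 6)
  set B : ℝ := (1 + δ) * KS ^ 2 / 6 * A with hBdef
  have hB : ∀ a' s : ℝ, a' ≤ s → ∫ σ in a'..s, Real.exp (-((1 / 2) * (s - σ))) * b σ ≤ B := by
    intro a' s has
    have e : (fun σ => Real.exp (-((1 / 2) * (s - σ))) * b σ) =
        fun σ => (1 + δ) * KS ^ 2 / 6 * (Real.exp (-((1 / 2) * (s - σ))) * β σ ^ 2) := by funext σ; rw [hbdef]; ring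
    rw [e, intervalIntegral.integral_const_mul]
    exact mul_le_mul_of_nonneg_left (hA a' s has) (by positivity)
  have hstr : ∀ σ : ℝ, ∀ R : ℝ, 1 ≤ R →
      2 * (∫ y, smoothTransition (2 - ‖y‖ ^ 2 / R ^ 2) ^ 2 *
        ⟪fderiv ℝ (lerayOrbit V σ) y (lerayVorticity V σ y), lerayVorticity V σ y⟫) ≤
        2 * (∫ y, smoothTransition (2 - ‖y‖ ^ 2 / R ^ 2) ^ 2 *
            frobeniusNormSq (fderiv ℝ (lerayVorticity V σ) y)) +
          0 * (∫ y, smoothTransition (2 - ‖y‖ ^ 2 / R ^ 2) ^ 2 * ‖lerayVorticity V σ y‖ ^ 2) +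
          b σ * (∫ y, ‖lerayVorticity V σ y‖ ^ 2) +
          (2 * c₁ ^ 2 / δ) / R *
            ∫ y in closedBall (0 : EuclideanSpace ℝ (Fin 3)) (2 * R), ‖lerayVorticity V σ y‖ ^ 2 :=
    fun σ R hR1 => two_mul_integral_sqCutoff_stretching_le_cubic hV hK hc₁ hR1 σ (hβ0 σ) (hΩ3 σ).1
      (hΩ3 σ).2 hδ
  have hr1 : 2 * 0 + B < 1 := by
    have e : B = 2 * q / (6 + q) := by
      rw [hBdef, hδdef, show (1 + (6 - q) / (6 + q)) * KS ^ 2 / 6 * A =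
        (1 + (6 - q) / (6 + q)) * q / 6 by rw [hqdef]; ring]
      have : (6 + q) ≠ 0 := by positivity
      field_simp
      ring
    rw [mul_zero, zero_add, e, div_lt_one (by linarith)]
    linarith
  have hB0 : 0 ≤ 2 * 0 + B := by rw [hBdef, mul_zero, zero_add]; exact mul_nonneg (by positivity) hA0
  exact lerayVorticity_eq_zero_of_contraction hV hK hB0 hr1 fun m hm s =>
    integral_sq_norm_lerayVorticity_le_of_forall_one_le_fun hV hK le_rfl (by positivity) hb0 hbc hB
      hstr hm s

/-- **The averaged `L³`-vorticity rung**: under the hypotheses of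
`lerayVorticity_eq_zero_of_cube_le_fun` the field vanishes identically on `t < 0`
(`…VorticityLThree.eq_zero_of_lerayVorticity_eq_zero`). For `β ≡ v` this is
`…VorticityLThree.eq_zero_of_vorticityLThree_lt`; in general the scale-invariant `L³`-vorticity
`√(−t)‖ω(t)‖_{L³}` may exceed `√3/KS` intermittently. [folklore energy method] -/
theorem eq_zero_of_vorticityLThree_avg_lt (hV : IsTypeIAncientMild C V) {K : ℝ}
    (hK : ∀ t : ℝ, t < 0 → ∫⁻ x, ‖fderiv ℝ (V t) x‖ₑ ^ 2 ≤ ENNReal.ofReal (K / Real.sqrt (-t)))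
    {β : ℝ → ℝ} (hβc : Continuous β) (hβ0 : ∀ σ, 0 ≤ β σ)
    (hΩ3 : ∀ σ : ℝ, Integrable (fun y => ‖lerayVorticity V σ y‖ ^ 3) ∧
      ∫ y, ‖lerayVorticity V σ y‖ ^ 3 ≤ β σ ^ 3)
    {A : ℝ} (hA : ∀ a s : ℝ, a ≤ s → ∫ σ in a..s, Real.exp (-((1 / 2) * (s - σ))) * β σ ^ 2 ≤ A)
    (hq : (SNormLESNormFDerivOfEqConst (EuclideanSpace ℝ (Fin 3))
        (volume : Measure (EuclideanSpace ℝ (Fin 3))) 2 : ℝ) ^ 2 * A < 6) :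
    ∀ t < 0, ∀ x, V t x = 0 :=
  eq_zero_of_lerayVorticity_eq_zero hV (lerayVorticity_eq_zero_of_cube_le_fun hV hK hβc hβ0 hΩ3 hA hq)

/-- Regularity form (quantifier shape of the crux). [folklore] -/
theorem not_singular_of_vorticityLThree_avg_lt (hV : IsTypeIAncientMild C V) {K : ℝ}
    (hK : ∀ t : ℝ, t < 0 → ∫⁻ x, ‖fderiv ℝ (V t) x‖ₑ ^ 2 ≤ ENNReal.ofReal (K / Real.sqrt (-t)))
    {β : ℝ → ℝ} (hβc : Continuous β) (hβ0 : ∀ σ, 0 ≤ β σ)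
    (hΩ3 : ∀ σ : ℝ, Integrable (fun y => ‖lerayVorticity V σ y‖ ^ 3) ∧
      ∫ y, ‖lerayVorticity V σ y‖ ^ 3 ≤ β σ ^ 3)
    {A : ℝ} (hA : ∀ a s : ℝ, a ≤ s → ∫ σ in a..s, Real.exp (-((1 / 2) * (s - σ))) * β σ ^ 2 ≤ A)
    (hq : (SNormLESNormFDerivOfEqConst (EuclideanSpace ℝ (Fin 3))
        (volume : Measure (EuclideanSpace ℝ (Fin 3))) 2 : ℝ) ^ 2 * A < 6) :
    ¬ (∀ r > 0, ∀ M : ℝ, ∃ t ∈ Set.Ioo (-(r ^ 2)) (0 : ℝ),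
        ∃ x ∈ Metric.ball (0 : EuclideanSpace ℝ (Fin 3)) r, M < ‖V t x‖) := by
  intro hsing
  obtain ⟨t, ht, x, -, hM⟩ := hsing 1 one_pos 0
  have h0 := eq_zero_of_vorticityLThree_avg_lt hV hK hβc hβ0 hΩ3 hA hq t ht.2 x
  rw [h0, norm_zero] at hM
  exact lt_irrefl _ hM

end LThree

/-! ### The averaged vorticity-amplitude rung -/

section Amplitude

/-- **The averaged vorticity-amplitude rung (similarity form).** Let `V ∈ 𝒟_{C,K}` (any `C`, `K`),
`γ : ℝ → ℝ` continuous and non-negative with `‖Ω(σ,y)‖ ≤ γ(σ)` for all `σ, y`, and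
`∫_a^s e^{−(s−σ)/2} γ(σ) dσ ≤ Γ` for all `a ≤ s`, with `Γ < √3/2`. Then `Ω ≡ 0`: lead g15's sharp
stretching bound `2∫φ_R²⟪DUΩ,Ω⟫ ≤ (2γ(σ)/√3)Z_∞(σ)` (`two_mul_integral_sqCutoff_stretching_le_sharp`)
has the time-dependent coefficient `b(σ) = 2γ(σ)/√3`, whose backward averages are `≤ (2/√3)Γ < 1`.
[folklore energy method] -/
theorem lerayVorticity_eq_zero_of_vorticity_le_fun (hV : IsTypeIAncientMild C V) {K : ℝ}
    (hK : ∀ t : ℝ, t < 0 → ∫⁻ x, ‖fderiv ℝ (V t) x‖ₑ ^ 2 ≤ ENNReal.ofReal (K / Real.sqrt (-t)))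
    {γ : ℝ → ℝ} (hγc : Continuous γ) (hγ0 : ∀ σ, 0 ≤ γ σ)
    (hΩ : ∀ σ y, ‖lerayVorticity V σ y‖ ≤ γ σ)
    {Γ : ℝ} (hΓ : ∀ a s : ℝ, a ≤ s → ∫ σ in a..s, Real.exp (-((1 / 2) * (s - σ))) * γ σ ≤ Γ)
    (hΓlt : Γ < Real.sqrt 3 / 2) :
    ∀ s y, lerayVorticity V s y = 0 := by
  have hs0 : 0 < Real.sqrt 3 := Real.sqrt_pos.2 (by norm_num)
  have hΓ0 : 0 ≤ Γ := by have := hΓ 0 0 le_rfl; rwa [intervalIntegral.integral_same] at this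
  set b : ℝ → ℝ := fun σ => 2 * γ σ * Real.sqrt 3 / 3 with hbdef
  have hb0 : ∀ σ, 0 ≤ b σ := fun σ => by
    show 0 ≤ 2 * γ σ * Real.sqrt 3 / 3
    exact div_nonneg (mul_nonneg (mul_nonneg zero_le_two (hγ0 σ)) hs0.le) (by norm_num)
  have hbc : Continuous b := ((continuous_const.mul hγc).mul continuous_const).div_const 3
  set B : ℝ := 2 * Real.sqrt 3 / 3 * Γ with hBdef
  have hB : ∀ a' s : ℝ, a' ≤ s → ∫ σ in a'..s, Real.exp (-((1 / 2) * (s - σ))) * b σ ≤ B := by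
    intro a' s has
    have e : (fun σ => Real.exp (-((1 / 2) * (s - σ))) * b σ) =
        fun σ => 2 * Real.sqrt 3 / 3 * (Real.exp (-((1 / 2) * (s - σ))) * γ σ) := by funext σ; rw [hbdef]; ring
    rw [e, intervalIntegral.integral_const_mul]
    exact mul_le_mul_of_nonneg_left (hΓ a' s has) (by positivity)
  have hstr : ∀ σ : ℝ, ∀ R : ℝ, 1 ≤ R →
      2 * (∫ y, smoothTransition (2 - ‖y‖ ^ 2 / R ^ 2) ^ 2 *
        ⟪fderiv ℝ (lerayOrbit V σ) y (lerayVorticity V σ y), lerayVorticity V σ y⟫) ≤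
        2 * (∫ y, smoothTransition (2 - ‖y‖ ^ 2 / R ^ 2) ^ 2 *
            frobeniusNormSq (fderiv ℝ (lerayVorticity V σ) y)) +
          0 * (∫ y, smoothTransition (2 - ‖y‖ ^ 2 / R ^ 2) ^ 2 * ‖lerayVorticity V σ y‖ ^ 2) +
          b σ * (∫ y, ‖lerayVorticity V σ y‖ ^ 2) +
          0 / R * ∫ y in closedBall (0 : EuclideanSpace ℝ (Fin 3)) (2 * R), ‖lerayVorticity V σ y‖ ^ 2 := by
    intro σ R hR1
    have hR : 0 < R := lt_of_lt_of_le one_pos hR1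
    have h := two_mul_integral_sqCutoff_stretching_le_sharp hV hK (hγ0 σ) σ (hΩ σ) hR
    have hD0 : 0 ≤ ∫ y, smoothTransition (2 - ‖y‖ ^ 2 / R ^ 2) ^ 2 *
        frobeniusNormSq (fderiv ℝ (lerayVorticity V σ) y) :=
      integral_nonneg fun y => mul_nonneg (sq_nonneg _) (frobeniusNormSq_nonneg _)
    rw [zero_mul, add_zero, zero_div, zero_mul, add_zero, hbdef]
    linarith
  have hr1 : 2 * 0 + B < 1 := by
    rw [mul_zero, zero_add, hBdef]
    have : Γ * Real.sqrt 3 < Real.sqrt 3 / 2 * Real.sqrt 3 := mul_lt_mul_of_pos_right hΓlt hs0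
    nlinarith [Real.sq_sqrt (show (0:ℝ) ≤ 3 by norm_num)]
  have hB0 : 0 ≤ 2 * 0 + B := by rw [hBdef, mul_zero, zero_add]; exact mul_nonneg (by positivity) hΓ0
  exact lerayVorticity_eq_zero_of_contraction hV hK hB0 hr1 fun m hm s =>
    integral_sq_norm_lerayVorticity_le_of_forall_one_le_fun hV hK le_rfl le_rfl hb0 hbc hB hstr hm s

/-- **The averaged vorticity-amplitude rung**: under the hypotheses of
`lerayVorticity_eq_zero_of_vorticity_le_fun` the field vanishes identically on `t < 0`. For
`γ ≡ C_ω` (`Γ = 2C_ω`) this is lead g15's `…VorticityAmplitude.eq_zero_of_vorticity_lt`; in physical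
time the hypothesis reads `∫_{−∞}^t √(−t)(−τ)^{−3/2}[(−τ)‖ω(τ)‖_∞]dτ ≤ Γ < √3/2`, i.e. the parabolic
backward MEAN of the scale-invariant vorticity amplitude below `√3/4`. [folklore energy method] -/
theorem eq_zero_of_vorticityAmplitude_avg_lt (hV : IsTypeIAncientMild C V) {K : ℝ}
    (hK : ∀ t : ℝ, t < 0 → ∫⁻ x, ‖fderiv ℝ (V t) x‖ₑ ^ 2 ≤ ENNReal.ofReal (K / Real.sqrt (-t)))
    {γ : ℝ → ℝ} (hγc : Continuous γ) (hγ0 : ∀ σ, 0 ≤ γ σ)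
    (hΩ : ∀ σ y, ‖lerayVorticity V σ y‖ ≤ γ σ)
    {Γ : ℝ} (hΓ : ∀ a s : ℝ, a ≤ s → ∫ σ in a..s, Real.exp (-((1 / 2) * (s - σ))) * γ σ ≤ Γ)
    (hΓlt : Γ < Real.sqrt 3 / 2) :
    ∀ t < 0, ∀ x, V t x = 0 :=
  eq_zero_of_lerayVorticity_eq_zero hV (lerayVorticity_eq_zero_of_vorticity_le_fun hV hK hγc hγ0 hΩ hΓ hΓlt)

/-- Regularity form (quantifier shape of the crux). [folklore] -/
theorem not_singular_of_vorticityAmplitude_avg_lt (hV : IsTypeIAncientMild C V) {K : ℝ}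
    (hK : ∀ t : ℝ, t < 0 → ∫⁻ x, ‖fderiv ℝ (V t) x‖ₑ ^ 2 ≤ ENNReal.ofReal (K / Real.sqrt (-t)))
    {γ : ℝ → ℝ} (hγc : Continuous γ) (hγ0 : ∀ σ, 0 ≤ γ σ)
    (hΩ : ∀ σ y, ‖lerayVorticity V σ y‖ ≤ γ σ)
    {Γ : ℝ} (hΓ : ∀ a s : ℝ, a ≤ s → ∫ σ in a..s, Real.exp (-((1 / 2) * (s - σ))) * γ σ ≤ Γ)
    (hΓlt : Γ < Real.sqrt 3 / 2) :
    ¬ (∀ r > 0, ∀ M : ℝ, ∃ t ∈ Set.Ioo (-(r ^ 2)) (0 : ℝ),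
        ∃ x ∈ Metric.ball (0 : EuclideanSpace ℝ (Fin 3)) r, M < ‖V t x‖) := by
  intro hsing
  obtain ⟨t, ht, x, -, hM⟩ := hsing 1 one_pos 0
  have h0 := eq_zero_of_vorticityAmplitude_avg_lt hV hK hγc hγ0 hΩ hΓ hΓlt t ht.2 x
  rw [h0, norm_zero] at hM
  exact lt_irrefl _ hM

end Amplitude

/-! ### The averaged `L⁶`-velocity rung -/

section LSix

/-- **The averaged `L⁶`-velocity rung (similarity form).** Let `V ∈ 𝒟_{C,K}` (any `C`, `K`), let
`w : ℝ → ℝ` be continuous and non-negative with `‖U(σ)‖⁶ ∈ L¹`, `∫‖U(σ)‖⁶ ≤ w(σ)⁶` for all `σ`, and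
suppose `∫_a^s e^{−(s−σ)/2} w(σ)⁴ dσ ≤ A` for all `a ≤ s`, with `q = KS²A`, `27q < 128`. Then
`Ω ≡ 0`: the `L⁶`-priced stretching bound (`two_mul_integral_sqCutoff_stretching_le_lsix`) has the
time-dependent `Z_R`-coefficient `a(σ) = (27/128)(1+δ)KS²w(σ)⁴`, moved onto `Z_∞ ≥ Z_R`; with
`δ = (128 − 27q)/(128 + 27q)` its backward averages are `≤ 54q/(128 + 27q) < 1`. [folklore energy method] -/
theorem lerayVorticity_eq_zero_of_pow_six_le_fun (hV : IsTypeIAncientMild C V) {K : ℝ}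
    (hK : ∀ t : ℝ, t < 0 → ∫⁻ x, ‖fderiv ℝ (V t) x‖ₑ ^ 2 ≤ ENNReal.ofReal (K / Real.sqrt (-t)))
    {w : ℝ → ℝ} (hwc : Continuous w) (hw0 : ∀ σ, 0 ≤ w σ)
    (hU6 : ∀ σ : ℝ, Integrable (fun y => ‖lerayOrbit V σ y‖ ^ 6) ∧
      ∫ y, ‖lerayOrbit V σ y‖ ^ 6 ≤ w σ ^ 6)
    {A : ℝ} (hA : ∀ a s : ℝ, a ≤ s → ∫ σ in a..s, Real.exp (-((1 / 2) * (s - σ))) * w σ ^ 4 ≤ A)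
    (hq : 27 * ((SNormLESNormFDerivOfEqConst (EuclideanSpace ℝ (Fin 3))
        (volume : Measure (EuclideanSpace ℝ (Fin 3))) 2 : ℝ) ^ 2 * A) < 128) :
    ∀ s y, lerayVorticity V s y = 0 := by
  set KS : ℝ := (SNormLESNormFDerivOfEqConst (EuclideanSpace ℝ (Fin 3))
        (volume : Measure (EuclideanSpace ℝ (Fin 3))) 2 : ℝ) with hKSdef
  have hKS0 : 0 ≤ KS := NNReal.coe_nonneg _
  have hC : 0 ≤ C := hV.nonneg
  obtain ⟨c₁, hc₁0, hc₁⟩ :=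
    exists_norm_fderiv_smoothTransition_cutoff_le (E := (EuclideanSpace ℝ (Fin 3)))
  have hΩi := fun σ => integrable_sq_norm_lerayVorticity hV hK σ
  have hA0 : 0 ≤ A := by have := hA 0 0 le_rfl; rwa [intervalIntegral.integral_same] at this
  set q : ℝ := KS ^ 2 * A with hqdef
  have hq0 : 0 ≤ q := by positivity
  have hq1 : 27 * q < 128 := hq
  set δ : ℝ := (128 - 27 * q) / (128 + 27 * q) with hδdef
  have hδ : 0 < δ := div_pos (by linarith) (by linarith)
  set b : ℝ → ℝ := fun σ => 27 / 128 * (1 + δ) * KS ^ 2 * w σ ^ 4 with hbdef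
  have hb0 : ∀ σ, 0 ≤ b σ := fun σ => by positivity
  have hbc : Continuous b := continuous_const.mul (hwc.pow 4)
  set B : ℝ := 27 / 128 * (1 + δ) * KS ^ 2 * A with hBdef
  have hB : ∀ a' s : ℝ, a' ≤ s → ∫ σ in a'..s, Real.exp (-((1 / 2) * (s - σ))) * b σ ≤ B := by
    intro a' s has
    have e : (fun σ => Real.exp (-((1 / 2) * (s - σ))) * b σ) =
        fun σ => 27 / 128 * (1 + δ) * KS ^ 2 * (Real.exp (-((1 / 2) * (s - σ))) * w σ ^ 4) := by funext σ; rw [hbdef]; ring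
    rw [e, intervalIntegral.integral_const_mul]
    exact mul_le_mul_of_nonneg_left (hA a' s has) (by positivity)
  have hstr : ∀ σ : ℝ, ∀ R : ℝ, 1 ≤ R →
      2 * (∫ y, smoothTransition (2 - ‖y‖ ^ 2 / R ^ 2) ^ 2 *
        ⟪fderiv ℝ (lerayOrbit V σ) y (lerayVorticity V σ y), lerayVorticity V σ y⟫) ≤
        2 * (∫ y, smoothTransition (2 - ‖y‖ ^ 2 / R ^ 2) ^ 2 *
            frobeniusNormSq (fderiv ℝ (lerayVorticity V σ) y)) +
          0 * (∫ y, smoothTransition (2 - ‖y‖ ^ 2 / R ^ 2) ^ 2 * ‖lerayVorticity V σ y‖ ^ 2) +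
          b σ * (∫ y, ‖lerayVorticity V σ y‖ ^ 2) +
          (2 * c₁ ^ 2 / δ + 4 * C * c₁) / R *
            ∫ y in closedBall (0 : EuclideanSpace ℝ (Fin 3)) (2 * R), ‖lerayVorticity V σ y‖ ^ 2 := by
    intro σ R hR1
    have h := two_mul_integral_sqCutoff_stretching_le_lsix hV hc₁ hR1 σ (hw0 σ) (hU6 σ).1 (hU6 σ).2 hδ
    have hZle : (∫ y, smoothTransition (2 - ‖y‖ ^ 2 / R ^ 2) ^ 2 * ‖lerayVorticity V σ y‖ ^ 2) ≤
        ∫ y, ‖lerayVorticity V σ y‖ ^ 2 := by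
      refine integral_mono_of_nonneg (Eventually.of_forall fun y =>
        mul_nonneg (sq_nonneg _) (sq_nonneg _)) (hΩi σ).1 (Eventually.of_forall fun y => ?_)
      have h1 := sqCutoff_le_one R y
      have h0 : 0 ≤ ‖lerayVorticity V σ y‖ ^ 2 := sq_nonneg _
      nlinarith
    have hmono := mul_le_mul_of_nonneg_left hZle (hb0 σ)
    rw [hbdef] at hmono ⊢
    rw [zero_mul, add_zero] at h
    linarith
  have hr1 : 2 * 0 + B < 1 := by
    have e : B = 54 * q / (128 + 27 * q) := by
      rw [hBdef, hδdef, show 27 / 128 * (1 + (128 - 27 * q) / (128 + 27 * q)) * KS ^ 2 * A =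
        27 / 128 * (1 + (128 - 27 * q) / (128 + 27 * q)) * q by rw [hqdef]; ring]
      have : (128 + 27 * q) ≠ 0 := by positivity
      field_simp
      ring
    rw [mul_zero, zero_add, e, div_lt_one (by linarith)]
    linarith
  have hB0 : 0 ≤ 2 * 0 + B := by rw [hBdef, mul_zero, zero_add]; exact mul_nonneg (by positivity) hA0
  exact lerayVorticity_eq_zero_of_contraction hV hK hB0 hr1 fun m hm s =>
    integral_sq_norm_lerayVorticity_le_of_forall_one_le_fun hV hK le_rfl (by positivity) hb0 hbc hB
      hstr hm s

/-- **The averaged `L⁶`-velocity rung**: under the hypotheses of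
`lerayVorticity_eq_zero_of_pow_six_le_fun` the field vanishes identically on `t < 0`. In physical
time: a continuous majorant `w` of `(−t)^{1/4}‖u(t)‖_{L⁶}` with
`∫_{−∞}^t √(−t)(−τ)^{−3/2} w⁴ dτ ≤ A`, `27KS²A < 128`, forces triviality. [folklore energy method] -/
theorem eq_zero_of_velocityLSix_avg_lt (hV : IsTypeIAncientMild C V) {K : ℝ}
    (hK : ∀ t : ℝ, t < 0 → ∫⁻ x, ‖fderiv ℝ (V t) x‖ₑ ^ 2 ≤ ENNReal.ofReal (K / Real.sqrt (-t)))
    {w : ℝ → ℝ} (hwc : Continuous w) (hw0 : ∀ σ, 0 ≤ w σ)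
    (hU6 : ∀ σ : ℝ, Integrable (fun y => ‖lerayOrbit V σ y‖ ^ 6) ∧
      ∫ y, ‖lerayOrbit V σ y‖ ^ 6 ≤ w σ ^ 6)
    {A : ℝ} (hA : ∀ a s : ℝ, a ≤ s → ∫ σ in a..s, Real.exp (-((1 / 2) * (s - σ))) * w σ ^ 4 ≤ A)
    (hq : 27 * ((SNormLESNormFDerivOfEqConst (EuclideanSpace ℝ (Fin 3))
        (volume : Measure (EuclideanSpace ℝ (Fin 3))) 2 : ℝ) ^ 2 * A) < 128) :
    ∀ t < 0, ∀ x, V t x = 0 :=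
  eq_zero_of_lerayVorticity_eq_zero hV (lerayVorticity_eq_zero_of_pow_six_le_fun hV hK hwc hw0 hU6 hA hq)

/-- Regularity form (quantifier shape of the crux). [folklore] -/
theorem not_singular_of_velocityLSix_avg_lt (hV : IsTypeIAncientMild C V) {K : ℝ}
    (hK : ∀ t : ℝ, t < 0 → ∫⁻ x, ‖fderiv ℝ (V t) x‖ₑ ^ 2 ≤ ENNReal.ofReal (K / Real.sqrt (-t)))
    {w : ℝ → ℝ} (hwc : Continuous w) (hw0 : ∀ σ, 0 ≤ w σ)
    (hU6 : ∀ σ : ℝ, Integrable (fun y => ‖lerayOrbit V σ y‖ ^ 6) ∧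
      ∫ y, ‖lerayOrbit V σ y‖ ^ 6 ≤ w σ ^ 6)
    {A : ℝ} (hA : ∀ a s : ℝ, a ≤ s → ∫ σ in a..s, Real.exp (-((1 / 2) * (s - σ))) * w σ ^ 4 ≤ A)
    (hq : 27 * ((SNormLESNormFDerivOfEqConst (EuclideanSpace ℝ (Fin 3))
        (volume : Measure (EuclideanSpace ℝ (Fin 3))) 2 : ℝ) ^ 2 * A) < 128) :
    ¬ (∀ r > 0, ∀ M : ℝ, ∃ t ∈ Set.Ioo (-(r ^ 2)) (0 : ℝ),
        ∃ x ∈ Metric.ball (0 : EuclideanSpace ℝ (Fin 3)) r, M < ‖V t x‖) := by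
  intro hsing
  obtain ⟨t, ht, x, -, hM⟩ := hsing 1 one_pos 0
  have h0 := eq_zero_of_velocityLSix_avg_lt hV hK hwc hw0 hU6 hA hq t ht.2 x
  rw [h0, norm_zero] at hM
  exact lt_irrefl _ hM

end LSix


end Summit.NavierStokesRegularity.NavierStokesRegularity.Theorems.FiniteDissipationLiouville.Averaged

end
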